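import Mathlib.Algebra.Homology.DerivedCategory.Ext.MapBijective
import HarnessLib

/-!
# `Ext`-comparison along a fully faithful exact functor with acyclic images of injectives

Mathlib's `CategoryTheory.Functor.mapExt_bijective_of_preservesInjectiveObjects` shows that a
fully faithful exact functor `F : C ⥤ D` between abelian categories induces bijections
`Extⁿ(X, Y) → Extⁿ(F X, F Y)` when `C` has enough injectives and `F` *preserves injective
objects*. The dimension-shifting argument only uses, for the fixed source `X`, that
`Extⁿ⁺¹(F X, F I) = 0` for every injective `I` of `C` — i.e. that the images of injectives are
*acyclic for `Ext(F X, –)`*, the form in which comparison theorems of Grothendieck topologies are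
proved (e.g. Bhatt–Scholze, *The pro-étale topology for schemes*, Cor. 5.1.6: for
`ν* : Ab(X_ét) → Ab(X_proét)` "it suffices to prove `Hᵖ(U, ν*I) = 0` for `I ∈ Ab(X_ét)` injective,
`p > 0`"; likewise the independence of sheaf cohomology from the coefficient universe). This file
proves that sharper statement:

* `Literature.Algebra.Homology.mapExt_bijective_of_subsingleton_ext_obj_injective` : if `F` is
  additive, exact, full and faithful, `C` has enough injectives and
  `Extⁿ⁺¹(F X, F I)` is trivial for all injective `I` and all `n`, then
  `F.mapExtAddHom X Y n : Extⁿ(X, Y) → Extⁿ(F X, F Y)` is bijective for all `Y`, `n`.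

The proof is Mathlib's, verbatim up to the one changed hypothesis: induction on `n`, an injective
presentation `0 → Y → I → Q → 0`, the covariant long exact `Ext(X, –)`-sequences in `C` and in `D`
(`Ext.covariant_sequence_exact₃'`, `covariant_sequence_exact₁`) and the four-lemma
(`AddMonoidHom.bijective_of_surjective_of_bijective_of_right_exact`).

## References

* B. Bhatt, P. Scholze, *The pro-étale topology for schemes*, Astérisque 369 (2015), proof of
  Cor. 5.1.6 and Cor. 5.1.9 (dimension shifting). [BhattScholze2015]

## Design notes

* Pure homological algebra, stated for arbitrary abelian `C`, `D` with `HasExt`; no sites. The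
  intended instances are `F = ν*` (Bhatt–Scholze §5) and `F = sheafCompose _ uliftFunctor`
  (change of coefficient universe), both on sheaves of abelian groups on the small étale site.
* Mathlib searches: `Functor.mapExt_bijective_of_preservesInjectiveObjects`,
  `Functor.mapExt_bijective_of_preservesProjectiveObjects` (the only bijectivity criteria);
  nothing with an acyclicity hypothesis. Nothing restated.
-/

universe w w' v v' u u'

namespace Literature.Algebra.Homology

open CategoryTheory CategoryTheory.Limits CategoryTheory.Abelian

variable {C : Type u} [Category.{v} C] [Abelian C] {D : Type u'} [Category.{v'} D] [Abelian D]
variable (F : C ⥤ D) [F.Additive] [PreservesFiniteLimits F] [PreservesFiniteColimits F]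

attribute [local simp] Ext.mapExactFunctor_comp Ext.mapExactFunctor_mk₀
  Ext.mapExactFunctor_extClass

/-- **`Ext`-comparison with acyclic images of injectives.** Let `F : C ⥤ D` be an additive, exact,
fully faithful functor between abelian categories, `C` with enough injectives, and let `X : C` be
such that `Extⁿ⁺¹(F X, F I)` is trivial for every injective `I` of `C` and every `n`. Then
`Extⁿ(X, Y) → Extⁿ(F X, F Y)` (Mathlib `Functor.mapExtAddHom`) is bijective for every `Y` and `n`.
Dimension shifting along an injective presentation of `Y`, exactly as in Mathlib's
`Functor.mapExt_bijective_of_preservesInjectiveObjects` (whose hypothesis "`F` preserves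
injective objects" is the special case where `F I` is itself injective); this is the formal
skeleton of Bhatt–Scholze's proof of Cor. 5.1.6 / Cor. 5.1.9.
[cite: BhattScholze2015, Cor. 5.1.6 (proof) and Cor. 5.1.9] -/
theorem mapExt_bijective_of_subsingleton_ext_obj_injective [F.Full] [F.Faithful] [HasExt.{w} C]
    [HasExt.{w'} D] [EnoughInjectives C] (X : C)
    (hX : ∀ (I : C), Injective I → ∀ n : ℕ, Subsingleton (Ext.{w'} (F.obj X) (F.obj I) (n + 1)))
    (Y : C) (n : ℕ) :
    Function.Bijective (F.mapExtAddHom X Y n) := by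
  induction n generalizing Y with
  | zero => simpa [Ext.mapExactFunctor₀] using ⟨F.map_injective, F.map_surjective⟩
  | succ n hn =>
    let I : InjectivePresentation Y := Classical.arbitrary _
    let S := ShortComplex.mk _ _ (cokernel.condition I.f)
    have : Subsingleton (Ext.{w'} (F.obj X) ((S.map F).X₂) (n + 1)) := hX _ I.injective n
    have hS : S.ShortExact := { exact := ShortComplex.exact_cokernel I.f }
    exact AddMonoidHom.bijective_of_surjective_of_bijective_of_right_exact _ _ _ _
      (F.mapExtAddHom X S.X₂ n) (F.mapExtAddHom X S.X₃ n) (F.mapExtAddHom X S.X₁ (n + 1))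
      (by cat_disch) (by cat_disch)
      ((ShortComplex.ab_exact_iff_function_exact _).mp
        (Ext.covariant_sequence_exact₃' X hS n (n + 1) rfl))
      ((ShortComplex.ab_exact_iff_function_exact _).mp
        (Ext.covariant_sequence_exact₃' (F.obj X) (hS.map F) n (n + 1) rfl))
      (hn _).surjective (hn _)
      (fun x₁ ↦ Ext.covariant_sequence_exact₁ _ hS x₁ (Ext.eq_zero_of_injective _) rfl)
      (fun y₁ ↦ Ext.covariant_sequence_exact₁ _ (hS.map F) y₁ (Subsingleton.elim _ _) rfl)

/-- The same comparison packaged as an additive isomorphism `Extⁿ(X, Y) ≃+ Extⁿ(F X, F Y)`.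
[cite: BhattScholze2015, Cor. 5.1.9] -/
noncomputable def mapExtAddEquivOfSubsingletonExtObjInjective [F.Full] [F.Faithful]
    [HasExt.{w} C] [HasExt.{w'} D] [EnoughInjectives C] (X : C)
    (hX : ∀ (I : C), Injective I → ∀ n : ℕ, Subsingleton (Ext.{w'} (F.obj X) (F.obj I) (n + 1)))
    (Y : C) (n : ℕ) :
    Ext.{w} X Y n ≃+ Ext.{w'} (F.obj X) (F.obj Y) n :=
  AddEquiv.ofBijective (F.mapExtAddHom X Y n)
    (mapExt_bijective_of_subsingleton_ext_obj_injective F X hX Y n)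

/-- On elements the isomorphism is Mathlib's `Ext.mapExactFunctor F`. [folklore] -/
@[simp] theorem mapExtAddEquivOfSubsingletonExtObjInjective_apply [F.Full] [F.Faithful]
    [HasExt.{w} C] [HasExt.{w'} D] [EnoughInjectives C] (X : C)
    (hX : ∀ (I : C), Injective I → ∀ n : ℕ, Subsingleton (Ext.{w'} (F.obj X) (F.obj I) (n + 1)))
    (Y : C) (n : ℕ) (e : Ext.{w} X Y n) :
    mapExtAddEquivOfSubsingletonExtObjInjective F X hX Y n e = e.mapExactFunctor F :=
  rfl

end Literature.Algebra.Homology
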